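import Literature.NumberTheory.NumberFields.CoinvariantGenusBound
import Literature.NumberTheory.NumberFields.ClassGroupNormSurjective
import Literature.NumberTheory.IwasawaTheory.ClassGroupPRankCoinvariantCriterion
import Literature.NumberTheory.IwasawaTheory.ZpExtensionNormKernelLayerPair
import Literature.NumberTheory.IwasawaTheory.ZpExtensionLayerTotallyRamifiedPrime
import Literature.NumberTheory.IwasawaTheory.ClassicalMuInvariantOnePrimeProofs
import HarnessLib

/-!
# `μ = 0` from GENUS THEORY at ONE pair of layers: `rank_p Cl(K_{n₀+1}) + t − 1 − r_E ≤ p − 1` ⟹ `μ(κ) = 0`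
# (the coinvariant criterion, door L12, with its hypothesis read in the LOWER layer through Chevalley's formula)

Topic `NumberTheory/IwasawaTheory` (namespace = path).  THEOREM-ONLY file (no definition, no named fact, no instance, no `sorry`), written by the
prover seat `bsd-2adic-k4-w2` GEN 14 (cell `bsd-2adic`; `--supports` stmt-BirchSwinnertonDyer-22617; closes nothing).

The ONE-PAIR-OF-LAYERS COINVARIANT CRITERION (`classicalMuVanishes_of_coinvariant_index_le_succ_succ`, seat `bsd-potss-k9-c4` g26) concludes
`μ(κ) = 0` and bounded `p`-ranks from `TotallyRamifiedFrom κ n₀` and ONE datum of the pair `(M, L) = (K_{n₀+1}, K_{n₀+2})`: the index of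
`Cl(L)^p · ⟨σc·c⁻¹ : σ ∈ Gal(L/M)⟩` is `≤ p^c`, `c ≤ p − 1`.  By the genus bound for the coinvariant quotient (`AmbiguousClass.index_pow_sup_closure_mul_le_genus`,
`NumberFields/CoinvariantGenusBound.lean`: `index · [L:M] · [E_M : E_M ∩ N Lˣ] ≤ [Cl(M) : Cl(M)^p] · ∏_𝔓 e_𝔓 · e_∞`) that datum follows from arithmetic of `M`
ALONE.  Here the pieces are assembled in the tower:

* `classGroupNorm_layer_succ_succ_surjective` — `N : Cl(K_{n₀+2}) → Cl(K_{n₀+1})` is onto under `TotallyRamifiedFrom κ n₀` (a prime of `K_{n₀+2}` is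
  totally ramified over `K_{n₀+1}`, tree `ZpExtension.exists_isMaximal_forall_mem_inertia` + Mathlib `Ideal.card_inertia_eq_ramificationIdxIn`; then
  `classGroupNorm_surjective_of_ramificationIdx_eq_finrank`).
* ★ `classicalMuVanishes_of_genus_bound_layer_succ_succ` — `TotallyRamifiedFrom κ n₀`, `c ≤ p − 1` and
  **`[Cl(M) : Cl(M)^p] · ∏_𝔓 e_𝔓(L/M) ≤ p^c · p · [E_M : E_M ∩ N_{L/M} Lˣ]`** (`M = K_{n₀+1} ⊆ L = K_{n₀+2}` with the inclusion algebra structure) ⟹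
  bounded `p`-ranks along the tower and `ClassicalMuVanishes κ`.  With `∏ e_𝔓 = p^t` (`finprod_ramificationIdxIn_eq_pow_of_prime`) and `p^r ∣ [E_M : E_M ∩ N]`
  this is `rank_p Cl(M) + t ≤ c + 1 + r`: `classicalMuVanishes_of_rank_add_le_layer_succ_succ`.
  At `p = 2`, `c = 1`: `rank₂ Cl(K_{n₀+1}) + t ≤ 2 + r` — e.g. `rank₂ Cl(K₁) = 1`, two `2`-adic primes, ONE unit of `K₁` outside `N(K₂ˣ)`.

HONEST SCOPE.  No class group is computed here; nothing about elliptic curves.  The unit norm index is Chevalley's `[E_M : E_M ∩ N Lˣ]` inside `Lˣ`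
(`unitsE L ⊓ …`, as in `AmbiguousClassNumberFormula.lean`); a lower bound `p^r ∣ …` is what `r` units of `M` with independent local obstructions give
(e.g. `AddKatoTwo.two_dvd_relIndex_of_nonNorm`, cell `bsd-2adic`).

References: [Washington1997] §13.3 Lemma 13.18, Prop. 13.22–13.23; [Fukuda1994] Thm. 1 (proof, p. 264); [Lang1990] Ch. 13 §4 Lemma 4.1; [Gras2003] IV.4;
[NeukirchANT1999] Ch. I §9 (9.6) (`#I = e` for Galois extensions).
-/

set_option autoImplicit false

noncomputable section

open scoped NumberField
open NumberField IsDedekindDomain Field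

namespace Literature.NumberTheory.IwasawaTheory

open Literature.NumberTheory.EllipticCurves Literature.NumberTheory.NumberFields
  Literature.NumberTheory.NumberFields.AmbiguousClass
  Literature.NumberTheory.GaloisRepresentations Literature.NumberTheory.GaloisRepresentations.Herbrand
  Literature.NumberTheory.GaloisRepresentations.MinkowskiUnit
  Literature.NumberTheory.GaloisRepresentations.CyclicNormIndex

variable {K : Type} [Field K] [NumberField K] {p : ℕ} [hp : Fact p.Prime]

/-- **`N : Cl(K_{n₀+2}) → Cl(K_{n₀+1})` is onto above the Fukuda index.**  `κ` a `ℤ_p`-extension of `K` with `TotallyRamifiedFrom κ n₀`; the layers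
`M = K_{n₀+1} ⊆ L = K_{n₀+2}` with the inclusion algebra structure.  Some prime `Q` of `L` has inertia group over `K` containing `Gal(L/M)`
(`ZpExtension.exists_isMaximal_forall_mem_inertia`), so its inertia group over `M` is all of `Gal(L/M)` and `e(Q | M) = [L : M]` (`#I = e`, Mathlib
`Ideal.card_inertia_eq_ramificationIdxIn`); a totally ramified prime makes the norm onto (`classGroupNorm_surjective_of_ramificationIdx_eq_finrank`).
[cite: Washington1997, §13.1 Lemma 13.3 and Thm. 10.1] [cite: NeukirchANT1999, Ch. I §9 Prop. (9.6)] -/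
theorem classGroupNorm_layer_succ_succ_surjective (κ : ZpExtension K p) {n₀ : ℕ} (hκ : TotallyRamifiedFrom κ n₀)
    [NumberField (κ.layer (n₀ + 1))] [NumberField (κ.layer (n₀ + (1 + 1)))] :
    letI : Algebra (κ.layer (n₀ + 1)) (κ.layer (n₀ + (1 + 1))) :=
      (IntermediateField.inclusion (κ.layer_mono (by omega))).toRingHom.toAlgebra
    Function.Surjective (classGroupNorm (κ.layer (n₀ + 1)) (κ.layer (n₀ + (1 + 1)))) := by
  classical
  set M := κ.layer (n₀ + 1)
  set L := κ.layer (n₀ + (1 + 1))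
  have hML : κ.layer (n₀ + 1) ≤ κ.layer (n₀ + (1 + 1)) := κ.layer_mono (by omega)
  letI : Algebra M L := (IntermediateField.inclusion hML).toRingHom.toAlgebra
  haveI : IsScalarTower K M L := IsScalarTower.of_algebraMap_eq fun x => ((IntermediateField.inclusion hML).commutes x).symm
  haveI : FiniteDimensional K M := κ.finiteDimensional_layer_holds _
  haveI : FiniteDimensional K L := κ.finiteDimensional_layer_holds _
  haveI : IsGalois K L := κ.isGalois_layer_holds _
  haveI : FiniteDimensional M L := Module.Finite.of_restrictScalars_finite K M L
  haveI : IsGalois M L := isGalois_layer_layer κ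
  obtain ⟨Q, hQmax, hQ⟩ := κ.exists_isMaximal_forall_mem_inertia hκ (n := n₀ + 1) (m := n₀ + (1 + 1)) (by omega) (by omega) (by omega)
  haveI := hQmax
  -- every `M`-automorphism of `L` lies in the inertia group of `Q`
  have htop : Q.inertia (L ≃ₐ[M] L) = ⊤ := by
    refine top_le_iff.mp fun τ _ => ?_
    have hK : τ.restrictScalars K ∈ Q.inertia (L ≃ₐ[K] L) := by
      refine hQ (τ.restrictScalars K) fun x hx => ?_
      have hx' : x = algebraMap M L ⟨(x : AlgebraicClosure K), hx⟩ := Subtype.ext rfl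
      rw [AlgEquiv.restrictScalars_apply, hx', AlgEquiv.commutes]
    intro x
    have h := hK x
    have heq : τ.restrictScalars K • x = τ • x := Subtype.ext rfl
    rwa [heq] at h
  -- hence `e(Q | M) = #Gal(L/M) = [L : M]`
  haveI : (Q.under (𝓞 M)).IsMaximal := Ideal.IsMaximal.under (𝓞 M) Q
  have hcard := Ideal.card_inertia_eq_ramificationIdxIn (G := L ≃ₐ[M] L) (Q.under (𝓞 M)) Q
  rw [htop, Subgroup.card_top, Nat.card_eq_fintype_card, ← Nat.card_eq_fintype_card, IsGalois.card_aut_eq_finrank,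
    Ideal.ramificationIdxIn_eq_ramificationIdx (Q.under (𝓞 M)) Q (L ≃ₐ[M] L)] at hcard
  exact classGroupNorm_surjective_of_ramificationIdx_eq_finrank M L Q hcard.symm

/-- ★ **`μ = 0` FROM GENUS THEORY AT ONE PAIR OF LAYERS.**  `κ` a `ℤ_p`-extension of the number field `K` with `TotallyRamifiedFrom κ n₀`; `M = K_{n₀+1}
⊆ L = K_{n₀+2}` (inclusion algebra structure); `c ≤ p − 1`.  IF **`[Cl(M) : Cl(M)^p] · ∏_𝔓 e_𝔓(L/M) ≤ p^c · p · [E_M : E_M ∩ N_{L/M} Lˣ]`** (Chevalley's unit norm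
index inside `Lˣ`) THEN the `p`-ranks `rank_p Cl(K_m)` are bounded and `μ(κ) = 0` (growth form `ClassicalMuVanishes`).  Proof: `Gal(L/M)` is cyclic of order `p`
with a generator `σ` (`isCyclic_aut_layer_layer`), unramified at infinity (`isUnramifiedAtInfinitePlaces_layer`), the norm is onto
(`classGroupNorm_layer_succ_succ_surjective`); the genus bound `AmbiguousClass.index_pow_sup_closure_mul_le_genus` for the family of `K`-automorphisms of `L`
fixing `M` (which contains `σ`) gives `index · p · [E:E∩N] ≤ [Cl(M):Cl(M)^p] · ∏e ≤ p^c · p · [E:E∩N]`, i.e. the hypothesis `hco` of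
`classicalMuVanishes_of_coinvariant_index_le_succ_succ`. [cite: Washington1997, §13.3 Lemma 13.18 and Prop. 13.22–13.23] [cite: Fukuda1994, Thm. 1 (proof, p. 264)]
[cite: Lang1990, Ch. 13 §4, Lemma 4.1 (PDF p. 203)] [cite: Gras2003, IV.4] -/
theorem classicalMuVanishes_of_genus_bound_layer_succ_succ (κ : ZpExtension K p) {n₀ : ℕ} (hκ : TotallyRamifiedFrom κ n₀)
    [NumberField (κ.layer (n₀ + 1))] [NumberField (κ.layer (n₀ + (1 + 1)))] {c : ℕ} (hc : c ≤ p - 1)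
    (hgen : letI : Algebra (κ.layer (n₀ + 1)) (κ.layer (n₀ + (1 + 1))) :=
        (IntermediateField.inclusion (κ.layer_mono (by omega))).toRingHom.toAlgebra
      (powMonoidHom p : ClassGroup (𝓞 (κ.layer (n₀ + 1))) →* ClassGroup (𝓞 (κ.layer (n₀ + 1)))).range.index *
          (∏ᶠ v : HeightOneSpectrum (𝓞 (κ.layer (n₀ + 1))), v.asIdeal.ramificationIdxIn (𝓞 (κ.layer (n₀ + (1 + 1))))) ≤
        p ^ c * p * (unitsE (κ.layer (n₀ + (1 + 1))) ⊓ (⊤ : Subgroup (κ.layer (n₀ + (1 + 1)))ˣ).map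
            (Herbrand.norm ((κ.layer (n₀ + (1 + 1))) ≃ₐ[κ.layer (n₀ + 1)] (κ.layer (n₀ + (1 + 1)))))).relIndex
          (unitsE (κ.layer (n₀ + (1 + 1))) ⊓ (unitsIncl (κ.layer (n₀ + 1)) (κ.layer (n₀ + (1 + 1)))).range)) :
    (∃ B : ℕ, ∀ m, classGroupPRank κ m ≤ B) ∧ ClassicalMuVanishes κ := by
  classical
  set M := κ.layer (n₀ + 1)
  set L := κ.layer (n₀ + (1 + 1))
  have hML : κ.layer (n₀ + 1) ≤ κ.layer (n₀ + (1 + 1)) := κ.layer_mono (by omega)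
  letI : Algebra M L := (IntermediateField.inclusion hML).toRingHom.toAlgebra
  haveI : IsScalarTower K M L := IsScalarTower.of_algebraMap_eq fun x => ((IntermediateField.inclusion hML).commutes x).symm
  haveI : FiniteDimensional K M := κ.finiteDimensional_layer_holds _
  haveI : FiniteDimensional K L := κ.finiteDimensional_layer_holds _
  haveI : IsGalois K L := κ.isGalois_layer_holds _
  haveI : FiniteDimensional M L := Module.Finite.of_restrictScalars_finite K M L
  haveI : IsGalois M L := isGalois_layer_layer κ
  haveI : IsUnramifiedAtInfinitePlaces K L := κ.isUnramifiedAtInfinitePlaces_layer _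
  haveI : IsUnramifiedAtInfinitePlaces M L := IsUnramifiedAtInfinitePlaces.top K M L
  -- `Gal(L/M)` cyclic of order `p`
  haveI : IsCyclic (L ≃ₐ[M] L) := isCyclic_aut_layer_layer' κ
  obtain ⟨σ, hσ⟩ := IsCyclic.exists_generator (α := L ≃ₐ[M] L)
  have hdeg : Module.finrank M L = p := by
    rw [finrank_layer_layer κ (show n₀ + 1 ≤ n₀ + (1 + 1) by omega)]
    simp
  have hN := classGroupNorm_layer_succ_succ_surjective κ hκ
  -- the family of `K`-automorphisms of `L` fixing `M` pointwise, seen as `M`-automorphisms: it contains `σ`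
  -- genus bound for the generator, unramified at infinity: `X · p · U ≤ Y · ∏e`
  have hgenus := index_pow_sup_range_mul_le_genus hσ hN p
  rw [archFactor_eq_one, mul_one, hdeg] at hgenus
  set X := ((powMonoidHom p : ClassGroup (𝓞 L) →* ClassGroup (𝓞 L)).range ⊔
      ((ClassGroup.mulEquiv (intAut σ)).toMonoidHom / MonoidHom.id (ClassGroup (𝓞 L))).range).index with hX
  set U := (unitsE L ⊓ (⊤ : Subgroup Lˣ).map (Herbrand.norm (L ≃ₐ[M] L))).relIndex (unitsE L ⊓ (unitsIncl M L).range) with hU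
  have hU0 : 0 < U := Nat.pos_of_ne_zero (relIndex_unitsNorm_ne_zero hσ).1
  have hXle : X ≤ p ^ c := by
    have h1 : X * p * U ≤ p ^ c * p * U := le_trans hgenus hgen
    have h2 : X * (p * U) ≤ p ^ c * (p * U) := by simpa [mul_assoc] using h1
    exact Nat.le_of_mul_le_mul_right h2 (Nat.mul_pos hp.out.pos hU0)
  -- the subgroup of the coinvariant criterion contains `Cl(L)^p ⊔ I_σ`
  have hco : ((powMonoidHom p : ClassGroup (𝓞 L) →* ClassGroup (𝓞 L)).range ⊔
      Subgroup.closure {x | ∃ (τ : L ≃ₐ[K] L)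
        (_ : ∀ y : L, ((y : L) : AlgebraicClosure K) ∈ κ.layer (n₀ + 1) → τ y = y)
        (x' : ClassGroup (𝓞 L)), x = ClassGroup.mulEquiv (AmbiguousClass.intAut τ) x' * x'⁻¹}).index ≤ p ^ c := by
    refine le_trans (Subgroup.index_antitone (sup_le_sup_left ?_ _)) hXle
    rintro x ⟨y, rfl⟩
    refine Subgroup.subset_closure ⟨σ.restrictScalars K, fun z hz => ?_, y, ?_⟩
    · have hz' : z = algebraMap M L ⟨(z : AlgebraicClosure K), hz⟩ := Subtype.ext rfl
      rw [AlgEquiv.restrictScalars_apply, hz', AlgEquiv.commutes]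
    · rw [MonoidHom.div_apply, MonoidHom.id_apply, div_eq_mul_inv]
      rfl
  exact classicalMuVanishes_of_coinvariant_index_le_succ_succ κ hκ hc hco

/-- **Rank form**: `TotallyRamifiedFrom κ n₀`, `c ≤ p − 1`, at the pair `M = K_{n₀+1} ⊆ L = K_{n₀+2}`: `t` primes of `M` ramified in `L`,
`[Cl(M) : Cl(M)^p] ≤ p^k`, `p^r ∣ [E_M : E_M ∩ N Lˣ]` and **`k + t ≤ c + 1 + r`** ⟹ bounded `p`-ranks and `μ(κ) = 0`.  (At `p = 2`, `c = 1`: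
`rank₂ Cl(K_{n₀+1}) + t ≤ 2 + r`.) [cite: Washington1997, §13.3 Prop. 13.23] [cite: Lang1990, Ch. 13 §4, Lemma 4.1] [cite: Gras2003, IV.4] -/
theorem classicalMuVanishes_of_rank_add_le_layer_succ_succ (κ : ZpExtension K p) {n₀ : ℕ} (hκ : TotallyRamifiedFrom κ n₀)
    [NumberField (κ.layer (n₀ + 1))] [NumberField (κ.layer (n₀ + (1 + 1)))] {c k r : ℕ} (hc : c ≤ p - 1)
    (hk : (powMonoidHom p : ClassGroup (𝓞 (κ.layer (n₀ + 1))) →* ClassGroup (𝓞 (κ.layer (n₀ + 1)))).range.index ≤ p ^ k)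
    (hr : letI : Algebra (κ.layer (n₀ + 1)) (κ.layer (n₀ + (1 + 1))) :=
        (IntermediateField.inclusion (κ.layer_mono (by omega))).toRingHom.toAlgebra
      p ^ r ∣ (unitsE (κ.layer (n₀ + (1 + 1))) ⊓ (⊤ : Subgroup (κ.layer (n₀ + (1 + 1)))ˣ).map
            (Herbrand.norm ((κ.layer (n₀ + (1 + 1))) ≃ₐ[κ.layer (n₀ + 1)] (κ.layer (n₀ + (1 + 1)))))).relIndex
          (unitsE (κ.layer (n₀ + (1 + 1))) ⊓ (unitsIncl (κ.layer (n₀ + 1)) (κ.layer (n₀ + (1 + 1)))).range))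
    (ht : letI : Algebra (κ.layer (n₀ + 1)) (κ.layer (n₀ + (1 + 1))) :=
        (IntermediateField.inclusion (κ.layer_mono (by omega))).toRingHom.toAlgebra
      k + {v : HeightOneSpectrum (𝓞 (κ.layer (n₀ + 1))) |
        v.asIdeal.ramificationIdxIn (𝓞 (κ.layer (n₀ + (1 + 1)))) ≠ 1}.ncard ≤ c + 1 + r) :
    (∃ B : ℕ, ∀ m, classGroupPRank κ m ≤ B) ∧ ClassicalMuVanishes κ := by
  classical
  set M := κ.layer (n₀ + 1)
  set L := κ.layer (n₀ + (1 + 1))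
  have hML : κ.layer (n₀ + 1) ≤ κ.layer (n₀ + (1 + 1)) := κ.layer_mono (by omega)
  letI : Algebra M L := (IntermediateField.inclusion hML).toRingHom.toAlgebra
  haveI : IsScalarTower K M L := IsScalarTower.of_algebraMap_eq fun x => ((IntermediateField.inclusion hML).commutes x).symm
  haveI : FiniteDimensional K M := κ.finiteDimensional_layer_holds _
  haveI : FiniteDimensional K L := κ.finiteDimensional_layer_holds _
  haveI : IsGalois K L := κ.isGalois_layer_holds _
  haveI : FiniteDimensional M L := Module.Finite.of_restrictScalars_finite K M L
  haveI : IsGalois M L := isGalois_layer_layer κ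
  have hdeg : Module.finrank M L = p := by
    rw [finrank_layer_layer κ (show n₀ + 1 ≤ n₀ + (1 + 1) by omega)]
    simp
  refine classicalMuVanishes_of_genus_bound_layer_succ_succ κ hκ hc ?_
  rw [finprod_ramificationIdxIn_eq_pow_of_prime hp.out hdeg]
  set t := {v : HeightOneSpectrum (𝓞 M) | v.asIdeal.ramificationIdxIn (𝓞 L) ≠ 1}.ncard
  set U := (unitsE L ⊓ (⊤ : Subgroup Lˣ).map (Herbrand.norm (L ≃ₐ[M] L))).relIndex (unitsE L ⊓ (unitsIncl M L).range)
  obtain ⟨m, hm⟩ := hr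
  haveI : IsCyclic (L ≃ₐ[M] L) := isCyclic_aut_layer_layer' κ
  obtain ⟨σ, hσ⟩ := IsCyclic.exists_generator (α := L ≃ₐ[M] L)
  have hU0 : U ≠ 0 := (relIndex_unitsNorm_ne_zero hσ).1
  have hm0 : 0 < m := by
    rcases Nat.eq_zero_or_pos m with h0 | h0
    · exact absurd (by rw [hm, h0, mul_zero]) hU0
    · exact h0
  have hp1 : 1 ≤ p := hp.out.pos
  calc (powMonoidHom p : ClassGroup (𝓞 M) →* ClassGroup (𝓞 M)).range.index * p ^ t
      ≤ p ^ k * p ^ t := Nat.mul_le_mul_right _ hk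
    _ = p ^ (k + t) := by rw [pow_add]
    _ ≤ p ^ (c + 1 + r) := Nat.pow_le_pow_right hp1 ht
    _ = p ^ c * p * p ^ r := by rw [pow_add, pow_add, pow_one]
    _ ≤ p ^ c * p * p ^ r * m := Nat.le_mul_of_pos_right _ hm0
    _ = p ^ c * p * U := by rw [hm]; ring

end Literature.NumberTheory.IwasawaTheory

end
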